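import Literature.AlgebraicGeometry.AbelianSchemes.AbelianSchemeAffineBase
import Mathlib.Algebra.DualNumber
import HarnessLib

/-!
# Points of an abelian scheme with values in `R`-algebras; `Lie(A/R) = ker(A(R[ε]) → A(R))`
# (cell hodgecm-mathlib rung 0, node F1-01b, part (i): the carriers of the Kottwitz determinant condition)

For an abelian scheme `A` over `Spec R` (`AbelianSchemeAffineBase`) and an `R`-algebra `S`, the `S`-VALUED POINTS
`A(S)` are the `R`-morphisms `Spec S → A` — the type `Motives.specOver R S ⟶ A.X` in `Over (Spec R)`, a GROUP under
Mathlib's scoped `Hom.group` (morphisms into a group object of a cartesian monoidal category), exactly as the tree's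
`Motives.AlgPoints` / `Motives.AbelianVariety.Points` over a field.  An `R`-algebra map `φ : S → S'` acts by
precomposition with `Spec φ`, a group homomorphism `A(S) → A(S')` (`pointsMap`; Mathlib `MonObj.comp_mul`): the
functor of points on `R`-algebras, which is how [Kottwitz1992, §5 (p. 390)] and [RapoportSmithlingZhang2020Diagonal]-style
PEL moduli problems read an abelian scheme («for every locally noetherian `O_E`-scheme `S` … the set of isomorphism
classes of `(A, λ, i, η̄)`» — test objects are functors on algebras).

The LIE ALGEBRA of `A/R` is recorded as the kernel of reduction modulo `ε`:
`Lie(A/R) := ker (A(R[ε]) → A(R))`, `R[ε] = R[T]/(T²)` Mathlib's `DualNumber R`, the map induced by the `R`-algebra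
projection `ε ↦ 0` (`TrivSqZeroExt.fstHom`) — [DemazureGabriel1970, II §4 no. 1] / [GortzWedhorn2020, (6.3) tangent
spaces via `k[ε]`]: for a group scheme `G` over `R`, `Lie(G)(R) = ker(G(R[ε]) → G(R))`.  This is the carrier on which
[Kottwitz1992, §5 (5.2) p. 390] imposes the DETERMINANT CONDITION «`det(T·1 − i(b) | Lie(A)) = …`» and
[RapoportSmithlingZhang2020Diagonal, (3.3)] the Kottwitz signature condition; the `R`-MODULE structure of `Lie(A/R)`
(scalars acting through `ε ↦ rε`), its local freeness of rank `relDim` for `A` smooth, and the condition itself are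
part (ii) of F1-01b (design memo on the cell bus, B-typ01 04:1xZ), NOT in this file.

Definitions with bodies + proved lemmas; no named fact, no `sorry`, no `instance` declaration (Mathlib's scoped
`Hom.group` is OPENED, not declared), no notation.  Cell hodgecm-mathlib, row I-1 programme (F1 DAG carriers,
director g1 HANDOFF §4 «typ01: F1 DAG carriers»); typer seat B-typ01.  HC_CM is proved only modulo the 7 printed
citations until rung 0 closes; this file discharges none of them.

## References
* [Kottwitz1992] R. E. Kottwitz, *Points on some Shimura varieties over finite fields*, J. Amer. Math. Soc. **5** (1992)
  373–444 — §5 (pp. 389–392), the determinant condition (5.2).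
* [GortzWedhorn2020] U. Görtz, T. Wedhorn, *Algebraic Geometry I*, 2nd ed. (2020) — Section (4.7) (p. 135) base change /
  functor of points (4.1), (6.3)–(6.4) tangent spaces and `k[ε]`-points (pp. 153–156).
* [MumfordFogartyKirwan1994] D. Mumford, J. Fogarty, F. Kirwan, *Geometric Invariant Theory*, 3rd ed. (1994), Ch. 6 §1
  Def. 6.1 (p. 115).
* Tree: `AbelianSchemes/AbelianSchemeAffineBase.lean` (carrier), `Motives/Varieties.lean` (`specOver`),
  `Motives/AlgPoints.lean` (the field-valued pattern `specMap`, `map`).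
-/

universe u

open CategoryTheory CategoryTheory.Limits AlgebraicGeometry
open scoped MonObj

noncomputable section

namespace Literature.AlgebraicGeometry.AbelianSchemes

open Literature.AlgebraicGeometry.Motives (SchemeOver specOver)

namespace AbelianScheme

variable {R : Type u} [CommRing R] (A : AbelianScheme R)

/-! ## `S`-valued points -/

/-- The **`S`-valued points `A(S)`** of the abelian scheme `A / Spec R` for an `R`-algebra `S`: `R`-morphisms
`Spec S → A`, i.e. the type `specOver R S ⟶ A.X` in `Over (Spec R)`; a group under Mathlib's scoped `Hom.group`
(`open scoped MonObj`). [cite: GortzWedhorn2020, Section (4.1) and (4.7) (p. 135)] [cite: Kottwitz1992, §5 (p. 390)] -/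
abbrev Points (S : Type u) [CommRing S] [Algebra R S] : Type u :=
  specOver R S ⟶ A.X

section Functoriality

variable {S S' S'' : Type u} [CommRing S] [Algebra R S] [CommRing S'] [Algebra R S'] [CommRing S''] [Algebra R S'']

/-- `Spec φ : Spec S' → Spec S` over `Spec R` for an `R`-algebra map `φ : S → S'` (the pattern of the tree's
`Motives.AlgPoints.specMap`; non-Prop plumbing). [folklore] -/
def specOverMap (φ : S →ₐ[R] S') : specOver R S' ⟶ specOver R S :=
  Over.homMk (Spec.map (CommRingCat.ofHom (φ : S →+* S'))) (by
    change Spec.map _ ≫ Spec.map _ = Spec.map _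
    rw [← Spec.map_comp, ← CommRingCat.ofHom_comp]
    congr 2
    exact RingHom.ext φ.commutes)

/-- The underlying scheme map of `specOverMap φ` is `Spec φ`. [cite: GortzWedhorn2020, Section (4.7) (p. 135)] -/
@[simp]
theorem specOverMap_left (φ : S →ₐ[R] S') :
    (specOverMap φ).left = Spec.map (CommRingCat.ofHom (φ : S →+* S')) := rfl

/-- `Spec (id) = id`. [cite: GortzWedhorn2020, Section (4.7) (p. 135)] -/
@[simp]
theorem specOverMap_id : specOverMap (AlgHom.id R S) = 𝟙 (specOver R S) := by
  ext : 1
  change Spec.map (CommRingCat.ofHom (RingHom.id S)) = 𝟙 (Spec (CommRingCat.of S))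
  rw [CommRingCat.ofHom_id, Spec.map_id]

/-- `Spec (ψ ∘ φ) = Spec φ ∘ Spec ψ`. [cite: GortzWedhorn2020, Section (4.7) (p. 135)] -/
theorem specOverMap_comp (φ : S →ₐ[R] S') (ψ : S' →ₐ[R] S'') :
    specOverMap (ψ.comp φ) = specOverMap ψ ≫ specOverMap φ := by
  ext : 1
  change Spec.map (CommRingCat.ofHom ((ψ : S' →+* S'').comp (φ : S →+* S'))) =
    Spec.map (CommRingCat.ofHom (ψ : S' →+* S'')) ≫ Spec.map (CommRingCat.ofHom (φ : S →+* S'))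
  rw [CommRingCat.ofHom_comp, Spec.map_comp]

/-- **Functoriality of points**: an `R`-algebra map `φ : S → S'` induces the GROUP homomorphism
`A(S) → A(S')`, `P ↦ P ∘ Spec φ` (precomposition with a morphism is multiplicative for the pointwise group law,
Mathlib `MonObj.comp_mul`). [cite: GortzWedhorn2020, Section (4.1) and (4.7) (p. 135)] [cite: Kottwitz1992, §5 (p. 390)] -/
def pointsMap (φ : S →ₐ[R] S') : A.Points S →* A.Points S' where
  toFun P := specOverMap φ ≫ P
  map_one' := MonObj.comp_one _
  map_mul' P Q := MonObj.comp_mul _ P Q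

/-- Unfolding of `pointsMap`. [cite: GortzWedhorn2020, Section (4.7) (p. 135)] -/
@[simp]
theorem pointsMap_apply (φ : S →ₐ[R] S') (P : A.Points S) : A.pointsMap φ P = specOverMap φ ≫ P := rfl

/-- `A(id) = id`. [cite: GortzWedhorn2020, Section (4.7) (p. 135)] -/
theorem pointsMap_id : A.pointsMap (AlgHom.id R S) = MonoidHom.id (A.Points S) := by
  ext P : 1
  simp

/-- `A(ψ ∘ φ) = A(ψ) ∘ A(φ)` (covariant in the algebra). [cite: GortzWedhorn2020, Section (4.7) (p. 135)] -/
theorem pointsMap_comp (φ : S →ₐ[R] S') (ψ : S' →ₐ[R] S'') :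
    A.pointsMap (ψ.comp φ) = (A.pointsMap ψ).comp (A.pointsMap φ) := by
  ext P : 1
  simp [specOverMap_comp]

end Functoriality

/-! ## `Lie(A/R) = ker (A(R[ε]) → A(R))` -/

/-- **Reduction modulo `ε`**: the group homomorphism `A(R[ε]) → A(R)` induced by the `R`-algebra projection
`R[ε] → R`, `ε ↦ 0` (Mathlib `TrivSqZeroExt.fstHom`, `R[ε] = DualNumber R`).
[cite: GortzWedhorn2020, Section (6.4) (p. 155)] -/
def dualNumberReduction : A.Points (DualNumber R) →* A.Points R :=
  A.pointsMap (TrivSqZeroExt.fstHom R R R)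

/-- Unfolding of `dualNumberReduction`. [cite: GortzWedhorn2020, Section (6.4) (p. 155)] -/
theorem dualNumberReduction_apply (P : A.Points (DualNumber R)) :
    A.dualNumberReduction P = specOverMap (TrivSqZeroExt.fstHom R R R) ≫ P := rfl

/-- **The Lie algebra `Lie(A/R)` as a group**: the kernel of `A(R[ε]) → A(R)` — the carrier on which
[Kottwitz1992, (5.2)] imposes the determinant condition «`det(T·1 − i(b) | Lie(A))`». (Its `R`-module structure and
local freeness are part (ii) of F1-01b, not recorded here.) [cite: GortzWedhorn2020, Section (6.4) (p. 155)]
[cite: Kottwitz1992, §5 (5.2) (p. 390)] -/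
def Lie : Subgroup (A.Points (DualNumber R)) :=
  A.dualNumberReduction.ker

/-- Membership in `Lie(A/R)`: a point of `A(R[ε])` reducing to the identity of `A(R)`.
[cite: GortzWedhorn2020, Section (6.4) (p. 155)] -/
theorem mem_Lie_iff (P : A.Points (DualNumber R)) : P ∈ A.Lie ↔ A.dualNumberReduction P = 1 :=
  MonoidHom.mem_ker

/-- The identity of `A(R[ε])` lies in `Lie(A/R)`. [cite: GortzWedhorn2020, Section (6.4) (p. 155)] -/
theorem one_mem_Lie : (1 : A.Points (DualNumber R)) ∈ A.Lie :=
  A.Lie.one_mem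

end AbelianScheme

end Literature.AlgebraicGeometry.AbelianSchemes

end
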